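import Summits.BirchSwinnertonDyer.BirchSwinnertonDyer.Theorems.KolyvaginRoadThreeRationalLiftGrossValue
import Summits.BirchSwinnertonDyer.Rank1Residual.Additive.LocIrrOddPrimes
import Summits.BirchSwinnertonDyer.Rank1Residual.X11b.TwistTransport
import Literature.NumberTheory.EllipticCurves.MatarNekovar2019.IrreducibleOverQuadraticFieldProofs
import Literature.NumberTheory.EllipticCurves.IrreducibleModPQuadraticTwistProofs
import Literature.NumberTheory.EllipticCurves.NonEisensteinPrimeOfSurjective
import Literature.NumberTheory.EllipticCurves.OpenImageMazurAssemblyProofs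
import Literature.NumberTheory.EllipticCurves.Castella2018.TamagawaQuadraticBaseChangeProofs
import Literature.NumberTheory.EllipticCurves.BSDSelmerSkinnerThmBProofs
import Literature.NumberTheory.EllipticCurves.HeegnerHypothesisKroneckerProofs
import HarnessLib

/-!
# Route `KolyvaginRoadThree`, crux `ZhangSharpFrameAtThreeHL` (item stmt-BirchSwinnertonDyer-19574), stub S1 on RATIONAL lifts:
# the E′-side Skinner hypotheses (irr), (irr) for the twist and (red@3) for the twist are CONGRUENCE-DETERMINED
# (cell `bsd-stepL`, seat `bsd-stepL-koly3b` g9; `--supports stmt-BirchSwinnertonDyer-19574`, helper)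

The refined first floor `H_sk` (file `KolyvaginRoadThreeRationalLiftSkinnerFirstFloor`, koly3b g9) asks of the rational lift
`E′ = W′/ℚ` (with `θ : E′[3] ⥲ E[3]` `Γ_K`-equivariant) and of a globally minimal model `Wd ≅ E′^{(d_K)}` Skinner's hypotheses at `3`:
(red@3), (irr), (ram). Three of them follow from the frame and `θ` — proved here, FACT-FREE (theorems only):

* `hasIrreducibleModPGaloisRep_of_threeCongruent` — (irr) for `E′` at `3`: `ρ̄_{E,3}` surjective ⟹ `E[3]` irreducible over `ℚ`
  (`hasIrreducibleModPGaloisRep_of_hasSurjectiveModNGaloisRep`) ⟹ over the Heegner field `K` (Matar–Nekovář Prop. 5.26 (2),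
  `hasIrreducibleModPGaloisRep_baseChange_of_coprime`; `(N, d_K) = 1` by the Heegner hypothesis) ⟹ `E′[3]` irreducible over `K`
  (transport along `θ⁻¹`, `Mazur1978.hasIrreducibleModPGaloisRep_of_addEquiv`) ⟹ over `ℚ` (descent,
  `Additive.hasIrreducibleModPGaloisRep_of_baseChange`).
* `hasIrreducibleModPGaloisRep_twistModel` — (irr) for `Wd`: `E′^{(d)}[3] ≅ E′[3] ⊗ χ_d`
  (`hasIrreducibleModPGaloisRep_iff_of_smul_eq_quadraticTwist`).
* `hasMultiplicativeReductionAtPrime_three_twistModel` — (red@3) for `Wd`: `3 ∣ N` splits in `K`, so `d_K ∈ (ℚ₃^×)²`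
  (`isSquare_padic_discr_of_splitsIn`) and `E′^{(d_K)} ≅ E′` over `ℚ₃` (`X11b.hasMultiplicativeReductionAtPrime_quadraticTwist_iff`,
  `hasMultiplicativeReductionAtPrime_smul_iff`).
* `grossValue_of_rationalLift_of_skinner'` — (GV′)_q with these three hypotheses discharged (the remaining instance-checkable ones:
  `W′` multiplicative at `3`, (ram) for `W′` and `Wd`, `htam`, (GZ)_q).

HONEST FRAMING: elementary transport; nothing is booked; closes nothing (T7). PARTITION: O2@3 (B10) × A1 × crux 19574 × stub S1,
brick R7 (E′-side) — proves-glue.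

References: [cite: MatarNekovar2019, Prop. 5.26 (2)] [cite: SilvermanAEC2009, X.5 Cor. 5.4, VII.5 Prop. 5.1(b)] [cite: Serre1972, §4]
[cite: Skinner2016PacificMC, Thm. C] [cite: WZhang2014, Thm. 7.1].
-/

noncomputable section

open scoped Classical

namespace Summit.BirchSwinnertonDyer.Rank1Residual.X11b.Three.Koly.RationalLift

open WeierstrassCurve Field NumberField IsDedekindDomain
open Literature.NumberTheory.EllipticCurves Literature.NumberTheory.EllipticCurves.ModularForms
  Literature.NumberTheory.GaloisRepresentations Literature.NumberTheory.Automorphic Module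
open Summit.BirchSwinnertonDyer.Rank1Residual.X11b.Three.Koly.Method2
open Summit.BirchSwinnertonDyer.Rank1Residual.X11b.Three.Koly.Method2DefiniteFirstFloor

section Transfer

variable (W : WeierstrassCurve ℚ) [W.IsElliptic] (K : Type) [Field K] [NumberField K]

/-- **(irr) for the rational lift is congruence-determined.** `E = W/ℚ` with `ρ̄_{E,3}` surjective, `K` an imaginary quadratic
Heegner field for `N = N_E`, and `E′ = W′/ℚ` with a `Γ_K`-equivariant `θ : E′[3] ⥲ E[3]`; then `E′[3]` is an irreducible
`Γ_ℚ`-module. (Surjective ⟹ irreducible over `ℚ` ⟹ irreducible over `K` by Matar–Nekovář 5.26 (2) since `(N, d_K) = 1` ⟹ transport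
along `θ⁻¹` ⟹ descend to `ℚ`.) [cite: MatarNekovar2019, Prop. 5.26 (2)] [cite: Serre1972, §4] -/
theorem hasIrreducibleModPGaloisRep_of_threeCongruent [NeZero (W.conductorNorm ℤ)]
    (hK : IsImaginaryQuadratic K) (hsurj : Rank1Residual.Surj W 3)
    (hH : SatisfiesHeegnerHypothesis (W.conductorNorm ℤ) K)
    (W' : WeierstrassCurve ℚ) [W'.IsElliptic]
    (θ : geomTorsion (W'.baseChange K) ((3 ^ 1 : ℕ) : ℤ) ≃+ geomTorsion (W.baseChange K) ((3 ^ 1 : ℕ) : ℤ))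
    (hθ : ∀ (σ : absoluteGaloisGroup K) (P : geomTorsion (W'.baseChange K) ((3 ^ 1 : ℕ) : ℤ)), θ (σ • P) = σ • θ P) :
    W'.HasIrreducibleModPGaloisRep 3 := by
  haveI : (W.baseChange K).IsElliptic := by rw [baseChange]; infer_instance
  haveI : (W'.baseChange K).IsElliptic := by rw [baseChange]; infer_instance
  -- irreducible over `ℚ`
  have hirrQ : W.HasIrreducibleModPGaloisRep 3 :=
    hasIrreducibleModPGaloisRep_of_hasSurjectiveModNGaloisRep W 3 hsurj
  -- irreducible over `K` (Matar–Nekovář: `(N, d_K) = 1`)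
  have hcop : Nat.Coprime (W.conductorNorm ℤ) (NumberField.discr K).natAbs :=
    Literature.SatisfiesHeegnerHypothesis.coprime_discr hK.1 hH
  have hirrK : (W.baseChange K).HasIrreducibleModPGaloisRep 3 :=
    MatarNekovar2019.hasIrreducibleModPGaloisRep_baseChange_of_coprime W K 3 hK.1 hcop (by norm_num) hirrQ
  -- transport along `θ⁻¹`
  have hθ' : ∀ (σ : absoluteGaloisGroup K) (Q : geomTorsion (W.baseChange K) ((3 ^ 1 : ℕ) : ℤ)),
      θ.symm (σ • Q) = σ • θ.symm Q := fun σ Q ↦ by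
    apply θ.injective
    rw [θ.apply_symm_apply, hθ, θ.apply_symm_apply]
  have hirrK' : (W'.baseChange K).HasIrreducibleModPGaloisRep 3 :=
    Mazur1978.hasIrreducibleModPGaloisRep_of_addEquiv (p := 3) θ.symm hθ' hirrK
  -- descend to `ℚ`
  exact Summit.BirchSwinnertonDyer.Rank1Residual.Additive.hasIrreducibleModPGaloisRep_of_baseChange W' K
    (by norm_num) hirrK'

/-- **(irr) for the twist model** `Wd ≅ E′^{(d_K)}` (`C • E′^{(d_K)} = Wd`): `E′^{(d)}[3] ≅ E′[3] ⊗ χ_d` is irreducible iff `E′[3]` is.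
[cite: SilvermanAEC2009, X.5 Cor. 5.4] -/
theorem hasIrreducibleModPGaloisRep_twistModel
    (W' : WeierstrassCurve ℚ) [W'.IsElliptic] (Wd : WeierstrassCurve ℚ) (C : VariableChange ℚ)
    (hCd : C • W'.quadraticTwist (NumberField.discr K : ℚ) = Wd) (hirr : W'.HasIrreducibleModPGaloisRep 3) :
    Wd.HasIrreducibleModPGaloisRep 3 := by
  have hd : (NumberField.discr K : ℚ) ≠ 0 := by exact_mod_cast NumberField.discr_ne_zero K
  have hC' : C⁻¹ • Wd = W'.quadraticTwist (NumberField.discr K : ℚ) := by rw [← hCd, inv_smul_smul]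
  exact (W'.hasIrreducibleModPGaloisRep_iff_of_smul_eq_quadraticTwist Wd hd hC' 3).mpr hirr

/-- **(red@3) for the twist model**: if `3 ∣ N` and `K` satisfies the Heegner hypothesis for `N` then `3` splits in `K`, `d_K` is a
square in `ℚ₃` and `E′^{(d_K)} ≅ E′` over `ℚ₃`; so `Wd ≅ E′^{(d_K)}` is multiplicative at `3` iff `E′` is.
[cite: SilvermanAEC2009, VII.5 Prop. 5.1(b), X.5 Cor. 5.4] -/
theorem hasMultiplicativeReductionAtPrime_three_twistModel {N : ℕ} (hK : IsImaginaryQuadratic K)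
    (hH : SatisfiesHeegnerHypothesis N K) (h3 : 3 ∣ N)
    (W' : WeierstrassCurve ℚ) [W'.IsElliptic] (Wd : WeierstrassCurve ℚ) (C : VariableChange ℚ)
    (hCd : C • W'.quadraticTwist (NumberField.discr K : ℚ) = Wd) (hmult : W'.HasMultiplicativeReductionAtPrime 3) :
    Wd.HasMultiplicativeReductionAtPrime 3 := by
  have hd : (NumberField.discr K : ℚ) ≠ 0 := by exact_mod_cast NumberField.discr_ne_zero K
  haveI : (W'.quadraticTwist (NumberField.discr K : ℚ)).IsElliptic := W'.isElliptic_quadraticTwist hd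
  have hsq : IsSquare (algebraMap ℚ ℚ_[3] (NumberField.discr K : ℚ)) := by
    have h := Castella2018.TamagawaQuadratic.isSquare_padic_discr_of_splitsIn (K := K) hK.1 (ℓ := 3) (hH 3 Nat.prime_three h3)
    simpa using h
  have htw : (W'.quadraticTwist (NumberField.discr K : ℚ)).HasMultiplicativeReductionAtPrime 3 :=
    (Summit.BirchSwinnertonDyer.Rank1Residual.X11b.hasMultiplicativeReductionAtPrime_quadraticTwist_iff W' hd hsq).mpr hmult
  rw [← hCd]
  exact (hasMultiplicativeReductionAtPrime_smul_iff _ C 3).mpr htw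

end Transfer

/-! ## (GV′)_q with the congruence-determined hypotheses discharged -/

section GV

variable (W : WeierstrassCurve ℚ) [W.IsElliptic] [W.IsGloballyMinimal] (K : Type) [Field K] [NumberField K]
  [NeZero (W.conductorNorm ℤ)]

/-- **(GV′)_q for a rational lift from Skinner C (1)+(2) + GZK BY NAME + (GZ)_q + Tamagawa bookkeeping, with (irr) for `E′`, (irr) and
(red@3) for the twist model discharged from the frame** (`ρ̄_{E,3}` surjective, Heegner hypothesis, `3 ∣ N`, `θ`). Remaining
instance-checkable inputs: `W′` globally minimal and multiplicative at `3`, (ram) for `W′` and for `Wd`, `htam`, (GZ)_q.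
[cite: WZhang2014, Thm. 7.1, (7.2)–(7.3), Cor. 6.2, Thm. 6.4] [cite: Skinner2016PacificMC, Thm. C] [cite: MatarNekovar2019, Prop. 5.26 (2)] -/
theorem grossValue_of_rationalLift_of_skinner'
    (hC2 : Skinner2016.thmC_one_le_selmerCorank_of_L_one_eq_zero)
    (hC : Skinner2016.thmC_padicValRat_bsd_rank_zero)
    (hGZK : rank_eq_analyticRank_of_analyticRank_le_one)
    (hK : IsImaginaryQuadratic K) (hsurj : Rank1Residual.Surj W 3) (hH : SatisfiesHeegnerHypothesis (W.conductorNorm ℤ) K)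
    (h3 : 3 ∣ W.conductorNorm ℤ) (q : {q // IsUAdmissiblePrime W K q})
    (W' : WeierstrassCurve ℚ) [W'.IsElliptic] [W'.IsGloballyMinimal]
    (θ : geomTorsion (W'.baseChange K) ((3 ^ 1 : ℕ) : ℤ) ≃+ geomTorsion (W.baseChange K) ((3 ^ 1 : ℕ) : ℤ))
    (hθ : ∀ (σ : absoluteGaloisGroup K) (P : geomTorsion (W'.baseChange K) ((3 ^ 1 : ℕ) : ℤ)), θ (σ • P) = σ • θ P)
    (Wd : WeierstrassCurve ℚ) [Wd.IsElliptic] [Wd.IsGloballyMinimal] (C : VariableChange ℚ)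
    (hCd : C • W'.quadraticTwist (NumberField.discr K : ℚ) = Wd)
    (hmult3 : W'.HasMultiplicativeReductionAtPrime 3)
    (hram : ∃ ℓ : ℕ, ∃ _ : Fact ℓ.Prime, ℓ ≠ 3 ∧ W'.HasMultiplicativeReductionAtPrime ℓ ∧ ¬ 3 ∣ padicValInt ℓ W'.minimalDiscriminantInt)
    (hram_d : ∃ ℓ : ℕ, ∃ _ : Fact ℓ.Prime, ℓ ≠ 3 ∧ Wd.HasMultiplicativeReductionAtPrime ℓ ∧ ¬ 3 ∣ padicValInt ℓ Wd.minimalDiscriminantInt)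
    (htam : padicValNat 3 (W'.tamagawaProduct * Wd.tamagawaProduct) = padicValNat 3 (padicValInt (q : ℕ) W'.minimalDiscriminantInt))
    (hGZ : ∀ (S : Brandt.XiSetup (W.conductorNorm ℤ) (q : ℕ)) [Fintype (Brandt.ClassSet S.O)]
      (x₀ : GrossSpace S.D K) (φ : Brandt.ClassSet S.O → ℤ), x₀ ∈ grossPoints K S 1 → IsModThreeEigenline W S φ →
      ∀ r rd : ℚ, W'.entireLFunction 1 / (W'.realPeriodRat : ℂ) = (r : ℂ) → Wd.entireLFunction 1 / (Wd.realPeriodRat : ℂ) = (rd : ℂ) →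
        r * rd ≠ 0 →
        grossPeriod K S φ x₀ ≠ 0 ∧
          2 * (padicValInt 3 (grossPeriod K S φ x₀) : ℤ) + padicValNat 3 (padicValInt (q : ℕ) W'.minimalDiscriminantInt) =
            padicValRat 3 (r * rd)) :
    ∀ (S : Brandt.XiSetup (W.conductorNorm ℤ) (q : ℕ)) [Fintype (Brandt.ClassSet S.O)]
      (x₀ : GrossSpace S.D K) (φ : Brandt.ClassSet S.O → ℤ),
      x₀ ∈ grossPoints K S 1 → IsModThreeEigenline W S φ →
      selmerGroup (W'.baseChange K) ((3 ^ 1 : ℕ) : ℤ) = ⊥ → ¬ (3 : ℤ) ∣ grossPeriod K S φ x₀ :=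
  have hirr : W'.HasIrreducibleModPGaloisRep 3 := hasIrreducibleModPGaloisRep_of_threeCongruent W K hK hsurj hH W' θ hθ
  grossValue_of_rationalLift_of_skinner W K hC2 hC hGZK hK.1 q W' Wd C hCd (Or.inr hmult3) hirr hram
    (Or.inr (hasMultiplicativeReductionAtPrime_three_twistModel K hK hH h3 W' Wd C hCd hmult3))
    (hasIrreducibleModPGaloisRep_twistModel K W' Wd C hCd hirr) hram_d htam hGZ

end GV

end Summit.BirchSwinnertonDyer.Rank1Residual.X11b.Three.Koly.RationalLift

end
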